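import Literature.MathematicalPhysics.QuantumFieldTheory.OSTimeContinuation
import Mathlib.Analysis.SpecialFunctions.Trigonometric.DerivHyp
import Mathlib.Analysis.Calculus.ParametricIntegral
import HarnessLib

/-!
# The one-parameter groups of boosts: generator, derivatives, and regularised pairings

Support file (everything proved; no definitions, no named facts) for (B)
`Literature.MathematicalPhysics.QuantumFieldTheory.OS1973_lorentzInvariant_of_timeContinuation`
(`OSTimeContinuation`; Osterwalder–Schrader I (1973), §4.2). The boosts `B_j(s) = boost j s`
(`MinkowskiGeometry`) in the `(0, j)`-plane form a differentiable one-parameter group with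
generator `b(y) = y^j e₀ + y⁰ e_j` (the `X_{0j}` of OS I (4.14) on space-time points):

* `boost_apply_eq_cosh_sinh` (`B(s) y = cosh s · a(y) + sinh s · b(y) + (y − a(y))`,
  `a(y) = y⁰ e₀ + y^j e_j`), `hasDerivAt_boost` (`d/ds B(s) y = b(B(s) y)`),
  `boost_apply_boostGen` (`B(s) b(y) = b(B(s) y)`), `boost_symm_apply`, `boost_zero_apply'`;
* the diagonal action on configurations: joint continuity and smoothness in `(s, x)`
  (`continuous_boost_diag`, `contDiff_boost_neg_diag`), the derivative of `s ↦ B(−s) x`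
  (`hasDerivAt_boost_neg_diag`), and the chain rule
  `D(F ∘ B(−s))(x)(b x) = DF(B(−s)x)(b(B(−s)x))` (`fderiv_comp_boost_neg_diag_boostGen`);
* **differentiation of the regularised pairings under the integral sign**: for `V` continuous and
  `F` smooth of compact support, `s ↦ ∫ V(x) F(B(−s) x) dx` has derivative
  `−∫ V(x) DF(B(−s)x)(b(B(−s)x)) dx` (`hasDerivAt_integral_mul_comp_boost_neg`).

These are the ingredients of the exponentiation `X_{0j} T = 0 ⇒ T ∘ B_j(s) = T` of the
infinitesimal boost invariance of the OS boundary values (sequel files).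

## References

* K. Osterwalder, R. Schrader, *Axioms for Euclidean Green's functions*, Comm. Math. Phys. 31
  (1973) 83–112, §4.2, (4.14). [OsterwalderSchraderCMP1973]
* R. F. Streater, A. S. Wightman, *PCT, Spin and Statistics, and All That* (1964), §1-3 (boosts).
  [StreaterWightman1964]
-/

noncomputable section

open Filter Set MeasureTheory Metric
open scoped Topology ContDiff
open Literature.MathematicalPhysics.QuantumLattice

namespace Literature.MathematicalPhysics.QuantumFieldTheory

variable {d n : ℕ}

/-! ### Boosts through `cosh` and `sinh`; the generator -/

/-- **The boost written with `cosh` and `sinh`**: `B(s) y = cosh s · a(y) + sinh s · b(y) + (y − a(y))`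
with `a(y) = y⁰ e₀ + y^j e_j` and the generator `b(y) = y^j e₀ + y⁰ e_j`. [folklore] -/
theorem boost_apply_eq_cosh_sinh (j : Fin d) (s : ℝ) (y : SpaceTime d) :
    boost j s y =
      Real.cosh s • ((y 0) • e₀ d + (y j.succ) • EuclideanSpace.single j.succ (1 : ℝ)) +
      Real.sinh s • ((y j.succ) • e₀ d + (y 0) • EuclideanSpace.single j.succ (1 : ℝ)) +
      (y - ((y 0) • e₀ d + (y j.succ) • EuclideanSpace.single j.succ (1 : ℝ))) := by
  have hne : (0 : Fin (d + 1)) ≠ j.succ := (Fin.succ_ne_zero j).symm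
  ext i
  simp only [boost_apply, boostLin_apply, PiLp.add_apply, PiLp.smul_apply, PiLp.sub_apply, e₀_apply,
    PiLp.single_apply, smul_eq_mul]
  by_cases h0 : i = 0
  · subst h0
    simp [hne]
  · by_cases hj : i = j.succ
    · subst hj
      simp [Fin.succ_ne_zero]
      try ring
    · simp [h0, hj]

/-- The generator along the orbit: `cosh s · b(y) + sinh s · a(y) = b(B(s) y)`. [folklore] -/
theorem boostGen_boost (j : Fin d) (s : ℝ) (y : SpaceTime d) :
    Real.cosh s • ((y j.succ) • e₀ d + (y 0) • EuclideanSpace.single j.succ (1 : ℝ)) +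
      Real.sinh s • ((y 0) • e₀ d + (y j.succ) • EuclideanSpace.single j.succ (1 : ℝ)) =
      (boost j s y j.succ) • e₀ d + (boost j s y 0) • EuclideanSpace.single j.succ (1 : ℝ) := by
  have hne : (0 : Fin (d + 1)) ≠ j.succ := (Fin.succ_ne_zero j).symm
  ext i
  simp only [boost_apply, boostLin_apply, PiLp.add_apply, PiLp.smul_apply, e₀_apply,
    PiLp.single_apply, smul_eq_mul, if_true, Fin.succ_ne_zero, if_false]
  by_cases h0 : i = 0
  · subst h0
    simp [hne]
    try ring
  · by_cases hj : i = j.succ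
    · subst hj
      simp [Fin.succ_ne_zero]
      try ring
    · simp [h0, hj]

/-- **Boosts commute with their generator**: `B(s) b(y) = b(B(s) y)`. [folklore] -/
theorem boost_apply_boostGen (j : Fin d) (s : ℝ) (y : SpaceTime d) :
    boost j s ((y j.succ) • e₀ d + (y 0) • EuclideanSpace.single j.succ (1 : ℝ)) =
      (boost j s y j.succ) • e₀ d + (boost j s y 0) • EuclideanSpace.single j.succ (1 : ℝ) := by
  have hne : (0 : Fin (d + 1)) ≠ j.succ := (Fin.succ_ne_zero j).symm
  ext i
  simp only [boost_apply, boostLin_apply, PiLp.add_apply, PiLp.smul_apply, e₀_apply,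
    PiLp.single_apply, smul_eq_mul, if_true, Fin.succ_ne_zero, if_false]
  by_cases h0 : i = 0
  · subst h0
    simp [hne]
    try ring
  · by_cases hj : i = j.succ
    · subst hj
      simp [Fin.succ_ne_zero, hne]
      try ring
    · simp [h0, hj]

/-- **`d/ds B(s) y = b(B(s) y)`**: the boosts form a differentiable one-parameter group with
velocity field `b`. [folklore] -/
theorem hasDerivAt_boost (j : Fin d) (y : SpaceTime d) (s : ℝ) :
    HasDerivAt (fun s : ℝ => boost j s y)
      ((boost j s y j.succ) • e₀ d + (boost j s y 0) • EuclideanSpace.single j.succ (1 : ℝ)) s := by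
  have h : HasDerivAt (fun s : ℝ =>
      Real.cosh s • ((y 0) • e₀ d + (y j.succ) • EuclideanSpace.single j.succ (1 : ℝ)) +
      Real.sinh s • ((y j.succ) • e₀ d + (y 0) • EuclideanSpace.single j.succ (1 : ℝ)) +
      (y - ((y 0) • e₀ d + (y j.succ) • EuclideanSpace.single j.succ (1 : ℝ))))
      (Real.sinh s • ((y 0) • e₀ d + (y j.succ) • EuclideanSpace.single j.succ (1 : ℝ)) +
        Real.cosh s • ((y j.succ) • e₀ d + (y 0) • EuclideanSpace.single j.succ (1 : ℝ)) + 0) s :=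
    (((Real.hasDerivAt_cosh s).smul_const _).add ((Real.hasDerivAt_sinh s).smul_const _)).add
      (hasDerivAt_const s _)
  have hfun : (fun s : ℝ => boost j s y) = fun s : ℝ =>
      Real.cosh s • ((y 0) • e₀ d + (y j.succ) • EuclideanSpace.single j.succ (1 : ℝ)) +
      Real.sinh s • ((y j.succ) • e₀ d + (y 0) • EuclideanSpace.single j.succ (1 : ℝ)) +
      (y - ((y 0) • e₀ d + (y j.succ) • EuclideanSpace.single j.succ (1 : ℝ))) :=
    funext fun s => boost_apply_eq_cosh_sinh j s y
  rw [hfun]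
  refine h.congr_deriv ?_
  rw [add_zero, add_comm, boostGen_boost]

/-- `d/ds B(−s) y = −b(B(−s) y)`. [folklore] -/
theorem hasDerivAt_boost_neg (j : Fin d) (y : SpaceTime d) (s : ℝ) :
    HasDerivAt (fun s : ℝ => boost j (-s) y)
      (-((boost j (-s) y j.succ) • e₀ d + (boost j (-s) y 0) • EuclideanSpace.single j.succ (1 : ℝ))) s := by
  have h : HasDerivAt (fun s : ℝ => boost j (-s) y) ((-1 : ℝ) • ((boost j (-s) y j.succ) • e₀ d +
      (boost j (-s) y 0) • EuclideanSpace.single j.succ (1 : ℝ))) s :=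
    (hasDerivAt_boost j y (-s)).scomp s (hasDerivAt_neg s)
  exact h.congr_deriv (neg_one_smul ℝ _)

/-- The velocity of the inverse diagonal boosts on configurations. [folklore] -/
theorem hasDerivAt_boost_neg_diag (j : Fin d) (x : Fin n → SpaceTime d) (s : ℝ) :
    HasDerivAt (fun s : ℝ => fun k => boost j (-s) (x k))
      (fun k => -((boost j (-s) (x k) j.succ) • e₀ d +
        (boost j (-s) (x k) 0) • EuclideanSpace.single j.succ (1 : ℝ))) s :=
  hasDerivAt_pi.2 fun k => hasDerivAt_boost_neg j (x k) s

/-- `B(s) (B(−s) y) = y`. [folklore] -/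
theorem boost_apply_boost_neg (j : Fin d) (s : ℝ) (y : SpaceTime d) :
    boost j s (boost j (-s) y) = y := by
  have h := boostLin_neg_apply_boostLin j (-s) y
  rw [neg_neg] at h
  exact h

/-- The inverse of a boost is the boost with the opposite rapidity. [folklore] -/
theorem boost_symm_apply (j : Fin d) (s : ℝ) (y : SpaceTime d) :
    (boost j s).symm y = boost j (-s) y := by
  apply (boost j s).injective
  rw [ContinuousLinearEquiv.apply_symm_apply, boost_apply_boost_neg]

/-- The boost of rapidity `0` is the identity. [folklore] -/
theorem boost_zero_apply' (j : Fin d) (y : SpaceTime d) : boost j 0 y = y := by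
  ext i
  simp only [boost_apply, boostLin_apply, Real.cosh_zero, one_mul, Real.sinh_zero, zero_mul,
    add_zero, zero_add]
  split_ifs with h0 hj
  · subst h0; rfl
  · subst hj; rfl
  · rfl

/-! ### The diagonal action on configurations -/

/-- The projection to the `(0, j)`-planes of a configuration, as a continuous linear map. [folklore] -/
theorem exists_clm_planeProj_diag (j : Fin d) :
    ∃ A : (Fin n → SpaceTime d) →L[ℝ] (Fin n → SpaceTime d),
      ∀ x, A x = fun k => (x k 0) • e₀ d + (x k j.succ) • EuclideanSpace.single j.succ (1 : ℝ) :=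
  ⟨ContinuousLinearMap.pi fun k =>
    ((EuclideanSpace.proj (0 : Fin (d + 1))).comp (ContinuousLinearMap.proj k)).smulRight (e₀ d) +
    ((EuclideanSpace.proj j.succ).comp (ContinuousLinearMap.proj k)).smulRight
      (EuclideanSpace.single j.succ (1 : ℝ)), fun _ => rfl⟩

/-- The boost generator on configurations, as a continuous linear map. [folklore] -/
theorem exists_clm_boostGen_diag (j : Fin d) :
    ∃ B : (Fin n → SpaceTime d) →L[ℝ] (Fin n → SpaceTime d),
      ∀ x, B x = fun k => (x k j.succ) • e₀ d + (x k 0) • EuclideanSpace.single j.succ (1 : ℝ) :=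
  ⟨ContinuousLinearMap.pi fun k =>
    ((EuclideanSpace.proj j.succ).comp (ContinuousLinearMap.proj k)).smulRight (e₀ d) +
    ((EuclideanSpace.proj (0 : Fin (d + 1))).comp (ContinuousLinearMap.proj k)).smulRight
      (EuclideanSpace.single j.succ (1 : ℝ)), fun _ => rfl⟩

/-- **The inverse diagonal boosts depend smoothly on rapidity and configuration jointly.** [folklore] -/
theorem contDiff_boost_neg_diag (j : Fin d) :
    ContDiff ℝ ∞ fun p : ℝ × (Fin n → SpaceTime d) => fun k => boost j (-p.1) (p.2 k) := by
  obtain ⟨A, hA⟩ := exists_clm_planeProj_diag (n := n) j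
  obtain ⟨B, hB⟩ := exists_clm_boostGen_diag (n := n) j
  have hfun : (fun p : ℝ × (Fin n → SpaceTime d) => fun k => boost j (-p.1) (p.2 k)) =
      fun p => Real.cosh (-p.1) • A p.2 + Real.sinh (-p.1) • B p.2 + (p.2 - A p.2) := by
    funext p
    funext k
    rw [hA, hB]
    simp only [Pi.add_apply, Pi.smul_apply, Pi.sub_apply]
    exact boost_apply_eq_cosh_sinh j (-p.1) (p.2 k)
  rw [hfun]
  have h1 : ContDiff ℝ ∞ fun p : ℝ × (Fin n → SpaceTime d) => -p.1 := contDiff_neg.comp contDiff_fst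
  exact (((Real.contDiff_cosh.comp h1).smul (A.contDiff.comp contDiff_snd)).add
    ((Real.contDiff_sinh.comp h1).smul (B.contDiff.comp contDiff_snd))).add
    (contDiff_snd.sub (A.contDiff.comp contDiff_snd))

/-- The inverse diagonal boosts are jointly continuous. [folklore] -/
theorem continuous_boost_neg_diag (j : Fin d) :
    Continuous fun p : ℝ × (Fin n → SpaceTime d) => fun k => boost j (-p.1) (p.2 k) :=
  (contDiff_boost_neg_diag j).continuous

/-- The diagonal boosts are jointly continuous. [folklore] -/
theorem continuous_boost_diag (j : Fin d) :
    Continuous fun p : ℝ × (Fin n → SpaceTime d) => fun k => boost j p.1 (p.2 k) := by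
  have h := (continuous_boost_neg_diag (n := n) j).comp
    (continuous_fst.neg.prodMk continuous_snd :
      Continuous fun p : ℝ × (Fin n → SpaceTime d) => (-p.1, p.2))
  simpa [Function.comp_def] using h

/-- **The chain rule for the inverse boosts along the generator**:
`D(F ∘ B(−s))(x)(b x) = DF(B(−s) x)(b(B(−s) x))`, because `B(−s)` commutes with `b`. [folklore] -/
theorem fderiv_comp_boost_neg_diag_boostGen (j : Fin d) (s : ℝ) {F : (Fin n → SpaceTime d) → ℂ}
    (hF : Differentiable ℝ F) (x : Fin n → SpaceTime d) :
    fderiv ℝ (fun x : Fin n → SpaceTime d => F fun k => boost j (-s) (x k)) x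
        (fun k => (x k j.succ) • e₀ d + (x k 0) • EuclideanSpace.single j.succ (1 : ℝ)) =
      fderiv ℝ F (fun k => boost j (-s) (x k))
        (fun k => (boost j (-s) (x k) j.succ) • e₀ d +
          (boost j (-s) (x k) 0) • EuclideanSpace.single j.succ (1 : ℝ)) := by
  set L : (Fin n → SpaceTime d) →L[ℝ] (Fin n → SpaceTime d) :=
    (lorentzDiag n (boost j (-s)) : (Fin n → SpaceTime d) →L[ℝ] (Fin n → SpaceTime d)) with hL
  have hLx : ∀ x : Fin n → SpaceTime d, L x = fun k => boost j (-s) (x k) := fun x => rfl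
  have hcomp : (fun x : Fin n → SpaceTime d => F fun k => boost j (-s) (x k)) = F ∘ L := by
    funext x; rw [Function.comp_apply, hLx]
  rw [hcomp, ((hF _).hasFDerivAt.comp x L.hasFDerivAt).fderiv, ContinuousLinearMap.comp_apply, hLx,
    hLx]
  congr 1
  funext k
  exact boost_apply_boostGen j (-s) (x k)

/-! ### Differentiation of the regularised pairings -/

/-- **Rapidities in a compact interval move a compact set inside a compact set.** [folklore] -/
theorem isCompact_image_boost_diag (j : Fin d) {K : Set (Fin n → SpaceTime d)} (hK : IsCompact K)
    (s₀ : ℝ) :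
    IsCompact ((fun p : ℝ × (Fin n → SpaceTime d) => fun k => boost j p.1 (p.2 k)) ''
      (closedBall (0 : ℝ) s₀ ×ˢ K)) :=
  ((isCompact_closedBall _ _).prod hK).image (continuous_boost_diag j)

/-- **Differentiation of the regularised pairings under the integral sign**: for `V` continuous
and `F` smooth of compact support, `s ↦ ∫ V(x) F(B(−s) x) dx` is differentiable with derivative
`−∫ V(x) DF(B(−s) x)(b(B(−s) x)) dx` (dominated differentiation: for rapidities near `s` the
integrands are supported in a fixed compact set on which `V` is bounded). [folklore] -/
theorem hasDerivAt_integral_mul_comp_boost_neg (j : Fin d) {V : (Fin n → SpaceTime d) → ℂ}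
    (hV : Continuous V) {F : (Fin n → SpaceTime d) → ℂ} (hF : ContDiff ℝ ∞ F)
    (hFc : HasCompactSupport F) (s : ℝ) :
    HasDerivAt (fun s : ℝ => ∫ x, V x * F (fun k => boost j (-s) (x k)))
      (∫ x, V x * fderiv ℝ F (fun k => boost j (-s) (x k))
        (-(fun k => (boost j (-s) (x k) j.succ) • e₀ d +
          (boost j (-s) (x k) 0) • EuclideanSpace.single j.succ (1 : ℝ)))) s := by
  let ρ : ℝ → (Fin n → SpaceTime d) → (Fin n → SpaceTime d) := fun s x k => boost j s (x k)
  let Bg : (Fin n → SpaceTime d) → (Fin n → SpaceTime d) :=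
    fun x k => (x k j.succ) • e₀ d + (x k 0) • EuclideanSpace.single j.succ (1 : ℝ)
  have hρc : Continuous fun p : ℝ × (Fin n → SpaceTime d) => ρ p.1 p.2 := continuous_boost_diag j
  have hρs : ∀ s, Continuous (ρ s) := fun s =>
    continuous_pi fun k => (boost j s).continuous.comp (continuous_apply k)
  have hρρ : ∀ s x, ρ s (ρ (-s) x) = x := fun s x => funext fun k => boost_apply_boost_neg j s (x k)
  have hBc : Continuous Bg := by
    refine continuous_pi fun k => ?_
    have h1 : Continuous fun x : Fin n → SpaceTime d => x k j.succ :=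
      (EuclideanSpace.proj j.succ).continuous.comp (continuous_apply k)
    have h2 : Continuous fun x : Fin n → SpaceTime d => x k 0 :=
      (EuclideanSpace.proj 0).continuous.comp (continuous_apply k)
    exact (h1.smul continuous_const).add (h2.smul continuous_const)
  have hF1 : Differentiable ℝ F := hF.differentiable (by simp)
  have hFd : Continuous (fderiv ℝ F) := hF.continuous_fderiv (by simp)
  -- the compact set carrying everything for rapidities in `[s - 1, s + 1]`
  let K : Set (Fin n → SpaceTime d) :=
    (fun p : ℝ × (Fin n → SpaceTime d) => ρ p.1 p.2) '' (closedBall (0 : ℝ) (|s| + 1) ×ˢ tsupport F)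
  have hKc : IsCompact K := isCompact_image_boost_diag j hFc.isCompact _
  have hmemK : ∀ r ∈ ball s 1, ∀ x, ρ (-r) x ∈ tsupport F → x ∈ K := by
    intro r hr x hx
    refine ⟨(r, ρ (-r) x), ⟨mem_closedBall.2 ?_, hx⟩, hρρ r x⟩
    have h1 : |r - s| < 1 := by simpa [Real.dist_eq] using hr
    have h2 : |r| ≤ |r - s| + |s| := by
      have := abs_add_le (r - s) s; rwa [sub_add_cancel] at this
    rw [dist_zero_right, Real.norm_eq_abs]
    linarith
  -- bounds
  obtain ⟨C₁, hC₁⟩ := hFd.bounded_above_of_compact_support (hFc.fderiv ℝ)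
  obtain ⟨C₂', hC₂'⟩ := hFc.isCompact.exists_bound_of_continuousOn (f := Bg) hBc.continuousOn
  let C₂ : ℝ := max C₂' 0
  have hC₂ : ∀ y ∈ tsupport F, ‖Bg y‖ ≤ C₂ := fun y hy => (hC₂' y hy).trans (le_max_left _ _)
  have hC₂0 : 0 ≤ C₂ := le_max_right _ _
  have hC₁0 : 0 ≤ C₁ := (norm_nonneg _).trans (hC₁ 0)
  let bound : (Fin n → SpaceTime d) → ℝ := K.indicator fun x => C₁ * C₂ * ‖V x‖
  have hbound_int : Integrable bound := by
    rw [integrable_indicator_iff hKc.measurableSet]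
    exact (continuous_const.mul hV.norm).continuousOn.integrableOn_compact hKc
  let Φ : ℝ → (Fin n → SpaceTime d) → ℂ := fun r x => V x * F (ρ (-r) x)
  let Φ' : ℝ → (Fin n → SpaceTime d) → ℂ := fun r x =>
    V x * fderiv ℝ F (ρ (-r) x) (-(Bg (ρ (-r) x)))
  have hΦ'le : ∀ x, ∀ r ∈ ball s 1, ‖Φ' r x‖ ≤ bound x := by
    intro x r hr
    by_cases hx : ρ (-r) x ∈ tsupport F
    · have hxK : x ∈ K := hmemK r hr x hx
      simp only [bound, Φ']
      rw [indicator_of_mem hxK, norm_mul, mul_comm]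
      refine mul_le_mul_of_nonneg_right ?_ (norm_nonneg _)
      calc ‖fderiv ℝ F (ρ (-r) x) (-(Bg (ρ (-r) x)))‖
          ≤ ‖fderiv ℝ F (ρ (-r) x)‖ * ‖-(Bg (ρ (-r) x))‖ := ContinuousLinearMap.le_opNorm _ _
        _ ≤ C₁ * C₂ := by
            rw [norm_neg]
            exact mul_le_mul (hC₁ _) (hC₂ _ hx) (norm_nonneg _) hC₁0
    · have h0 : fderiv ℝ F (ρ (-r) x) = 0 := fderiv_of_notMem_tsupport ℝ hx
      have hb0 : 0 ≤ bound x := by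
        refine Set.indicator_nonneg (fun y _ => ?_) x
        exact mul_nonneg (mul_nonneg hC₁0 hC₂0) (norm_nonneg _)
      simp [Φ', h0, hb0]
  have hΦc : ∀ r, Continuous (Φ r) := fun r => hV.mul (hF.continuous.comp (hρs (-r)))
  have hΦ'c : ∀ r, Continuous (Φ' r) := fun r =>
    hV.mul ((hFd.comp (hρs (-r))).clm_apply (hBc.comp (hρs (-r))).neg)
  have hΦs : HasCompactSupport (Φ s) := by
    refine HasCompactSupport.of_support_subset_isCompact hKc fun x hx => ?_
    rw [Function.mem_support] at hx
    refine hmemK s (mem_ball_self one_pos) x ?_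
    by_contra hx'
    exact hx (by simp [Φ, image_eq_zero_of_notMem_tsupport hx'])
  have h_diff : ∀ x, ∀ r ∈ ball s 1, HasDerivAt (fun r => Φ r x) (Φ' r x) r := by
    intro x r _
    have hfx : HasFDerivAt F (fderiv ℝ F (ρ (-r) x)) (ρ (-r) x) := (hF1 _).hasFDerivAt
    exact (hfx.comp_hasDerivAt r (hasDerivAt_boost_neg_diag j x r)).const_mul (V x)
  exact (hasDerivAt_integral_of_dominated_loc_of_deriv_le (Metric.ball_mem_nhds s one_pos)
    (Eventually.of_forall fun r => (hΦc r).aestronglyMeasurable)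
    ((hΦc s).integrable_of_hasCompactSupport hΦs) (hΦ'c s).aestronglyMeasurable
    (Eventually.of_forall hΦ'le) hbound_int (Eventually.of_forall h_diff)).2

end Literature.MathematicalPhysics.QuantumFieldTheory
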